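import Mathlib.LinearAlgebra.Contraction
import Literature.Algebra.Lie.LefschetzModuleDiagonal
import Literature.Algebra.Lie.LefschetzModuleDual
import Literature.Algebra.Lie.LefschetzModuleLinearEquiv
import Literature.Algebra.Lie.LefschetzModuleInvariants
import HarnessLib

/-!
# `Hom(M', M'')` of two Lefschetz `𝔞`-modules is a Lefschetz `𝔞`-module, and its `𝔤`-invariants are the morphisms of
# Lefschetz `𝔞`-modules (Looijenga–Lunts 1997, §1 (1.1)–(1.3))

[topic Algebra/Lie]

Topic `Literature/Algebra/Lie` (namespace `Literature.Algebra.Lie`).  Lane `lit-hodgefound` (Track 2 foundations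
library), skeleton seat `lit-hodgefound-skel-1` (generation 45), row **A1-144** of
`run/shared/lean/pub/lit-hodgefound/SKELETON.md`.  DEFINITIONS WITH BODIES (`homAction`, `homDiagRep`, `negDualRep`) and
PROVED theorems; no named fact, no instance, no notation, no `sorry` (D-0026 net debt `0`).

THE POINT.  "The collection of Lefschetz modules is closed under direct sums, tensor products and taking duals" (1.1),
hence under internal `Hom`: `Hom(M', M'') ≅ M'^* ⊗ M''`.  With ONE `𝔞` acting on both (`e'_a = ρ₁ a` on `M'`,
`e''_a = ρ₂ a` on `M''`), `𝔞` acts on `Hom(M', M'')` by `e_a · φ = e''_a φ - φ e'_a` and the degree operator is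
`h · φ = h'' φ - φ h'` — the transport (A1-142 `IsLefschetzModule.of_linearEquiv`) along Mathlib's
`dualTensorHomEquiv : M'^* ⊗ M'' ≃ Hom(M', M'')` of the tensor product (A1-141 `isLefschetzModule_diagTensor`) of the
dual `(-𝔞ᵀ, M'^*)` (A1-94/95 `IsLefschetzModule.dual`) with `(𝔞, M'')`.  Looijenga–Lunts phrase invariant bilinear forms
this way ((1.3): "a bilinear map `φ : M × M → K` that defines a morphism of Lefschetz modules `M ⊗ M → K`"); the
pay-off recorded here is that the `𝔤(𝔞, Hom(M', M''))`-INVARIANTS of `Hom(M', M'')` (A1-143: the `𝔞`-invariants of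
degree `0`) are exactly the MORPHISMS of Lefschetz `𝔞`-modules `φ : M' → M''` (`φ h' = h'' φ`, `φ e'_a = e''_a φ`).

## Sources, VERBATIM (held text `paper:arxiv-alg-geom_9604014`, page/line numbers of that text)

> (§1 (1.1), p0004 L62–L63) "The collection of Lefschetz modules is closed under direct sums, tensor products and
> taking duals."
> (§1 (1.3), p0005 L1–L5) "Given a Lefschetz module `M` of `𝔞`, then an invariant bilinear form on `M` is a bilinear
> map `φ : M × M → K` that defines a morphism of Lefschetz modules `M ⊗ M → K` (where `𝔞` acts trivially on `K`): so
> `φ` is zero on `M_k × M_l` unless `k + l = 0` and `𝔞` preserves the form `φ` infinitesimally".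
> (§1 (1.2), p0004 L98–L100) "`M ≅ M' ⊗ M''` as Lefschetz `𝔞`-modules".

## What is formalised

* §1 (any commutative ring) **`homAction x y : φ ↦ y φ - φ x`** on `Hom(M', M'')` (`homAction_apply(_apply)`),
  **`homDiagRep ρ₁ ρ₂ : a ↦ homAction (e'_a) (e''_a)`**, **`negDualRep ρ₁ : a ↦ -e'_aᵀ`** (A1-95 `negDualMap` after `ρ₁`),
  `range_negDualRep`.
* §2 (field) the dictionary **`dualTensorHom_comp_rTensor_add_lTensor`**: under `ξ ⊗ n ↦ (m ↦ ξ(m) n)` the operator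
  `(-xᵀ) ⊗ 1 + 1 ⊗ y` of `M'^* ⊗ M''` becomes `homAction x y`; `conj_dualTensorHomEquiv_rTensor_add_lTensor`,
  `conj_dualTensorHomEquiv_comp_diagTensorRep`, `map_conj_dualTensorHomEquiv_range_diagTensorRep`.
* §3 (characteristic `0`, finite dimension) `IsLefschetzModule.negDualRep` (the dual `(-𝔞ᵀ, M'^*)` in this
  parametrisation), `IsLefschetzModule.nontrivial`, **`IsLefschetzModule.isLefschetzModule_hom`**: `(𝔞, Hom(M', M''))` is a
  Lefschetz module for `h · φ = h'' φ - φ h'` when `(𝔞, M')`, `(𝔞, M'')` are (so `𝔤(𝔞, Hom(M', M''))` is semisimple —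
  it is `Φ 𝔤(-𝔞ᵀ ⊗ 1 + 1 ⊗ 𝔞, M'^* ⊗ M'') Φ⁻¹` by A1-142 `map_lefschetzLieAlgebra_conj`).
* §4 **`IsLefschetzModule.mem_maxTrivSubmodule_hom_iff`**: `φ ∈ Hom(M', M'')^{𝔤(𝔞, Hom(M', M''))}` iff
  `φ h' = h'' φ` and `φ e'_a = e''_a φ` for all `a` — the invariants are the morphisms of Lefschetz `𝔞`-modules
  (A1-143 `IsLefschetzModule.mem_maxTrivSubmodule_iff`).

## SCOPE

The target `K` with trivial `𝔞`-action of (1.3) is not a Lefschetz module in the tree's sense (A1-88 requires a Lefschetz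
element), so "`M ⊗ M → K`" itself is not an instance of §3; invariant forms are A1-91/A1-97.  The morphisms of §4
intertwine all of the common Lie algebra `𝔤(𝔠, ·)` by `LefschetzModuleDiagonal.lean` §5 (not restated).

## References

* [LooijengaLunts1997] E. Looijenga, V. A. Lunts, *A Lie algebra attached to a projective variety*, Invent. Math. 129
  (1997) 361–412; arXiv:alg-geom/9604014. §1 (1.1) p. 4 L62–L63, (1.2) p. 4 L98–L100, (1.3) p. 5 L1–L5 (held
  `paper:arxiv-alg-geom_9604014`).
-/

noncomputable section

namespace Literature.Algebra.Lie

open Module Function Set LieModule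
open scoped TensorProduct

-- The commutator Lie ring of `𝔤𝔩(M) = Module.End K M`: Mathlib's reducible NON-instance `LieRing.ofAssociativeRing`,
-- enabled file-locally exactly as in `LefschetzModule.lean` and every file of the series.
attribute [local instance 100] LieRing.ofAssociativeRing

/-! ### §1 The action on `Hom(M', M'')` -/

section Defs

variable (K : Type*) [CommRing K] {A : Type*} [AddCommGroup A] [Module K A] {M N : Type*} [AddCommGroup M] [Module K M]
  [AddCommGroup N] [Module K N]

/-- **The action of a pair `(x, y) ∈ 𝔤𝔩(M') × 𝔤𝔩(M'')` on `Hom(M', M'')`: `φ ↦ y φ - φ x`** (the `Hom ≅ M'^* ⊗ M''` form of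
`(-xᵀ) ⊗ 1 + 1 ⊗ y`, §2). [cite: LooijengaLunts1997, §1 (1.1) p0004 L62–L63, (1.3) p0005 L1–L5] -/
def homAction (x : Module.End K M) (y : Module.End K N) : Module.End K (M →ₗ[K] N) :=
  LinearMap.llcomp K M N N y - LinearMap.lcomp K N x

variable {K}

/-- `homAction x y φ = y φ - φ x`. [cite: LooijengaLunts1997, §1 (1.3) p0005 L1–L5] -/
@[simp] theorem homAction_apply (x : Module.End K M) (y : Module.End K N) (φ : M →ₗ[K] N) :
    homAction K x y φ = y ∘ₗ φ - φ ∘ₗ x := rfl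

/-- `homAction x y φ m = y (φ m) - φ (x m)`. [cite: LooijengaLunts1997, §1 (1.3) p0005 L1–L5] -/
theorem homAction_apply_apply (x : Module.End K M) (y : Module.End K N) (φ : M →ₗ[K] N) (m : M) :
    homAction K x y φ m = y (φ m) - φ (x m) := rfl

/-- `homAction x y φ = 0 ↔ φ x = y φ` (`φ` intertwines `x` and `y`). [cite: LooijengaLunts1997, §1 (1.3) p0005 L1–L5] -/
theorem homAction_apply_eq_zero_iff {x : Module.End K M} {y : Module.End K N} {φ : M →ₗ[K] N} :
    homAction K x y φ = 0 ↔ φ ∘ₗ x = y ∘ₗ φ := by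
  rw [homAction_apply, sub_eq_zero, eq_comm]

variable (K) in
/-- **One `𝔞` acting on `Hom(M', M'')`**: `e_a · φ = e''_a φ - φ e'_a`. [cite: LooijengaLunts1997, §1 (1.1) p0004 L62–L63, (1.3) p0005 L1–L5] -/
def homDiagRep (ρ₁ : A →ₗ[K] Module.End K M) (ρ₂ : A →ₗ[K] Module.End K N) : A →ₗ[K] Module.End K (M →ₗ[K] N) where
  toFun a := homAction K (ρ₁ a) (ρ₂ a)
  map_add' a b := by
    refine LinearMap.ext fun φ ↦ LinearMap.ext fun m ↦ ?_
    simp only [homAction_apply_apply, map_add, LinearMap.add_apply]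
    abel
  map_smul' c a := by
    refine LinearMap.ext fun φ ↦ LinearMap.ext fun m ↦ ?_
    simp only [homAction_apply_apply, map_smul, LinearMap.smul_apply, RingHom.id_apply, smul_sub]

/-- `homDiagRep ρ' ρ'' a = homAction (e'_a) (e''_a)`. [cite: LooijengaLunts1997, §1 (1.3) p0005 L1–L5] -/
@[simp] theorem homDiagRep_apply (ρ₁ : A →ₗ[K] Module.End K M) (ρ₂ : A →ₗ[K] Module.End K N) (a : A) :
    homDiagRep K ρ₁ ρ₂ a = homAction K (ρ₁ a) (ρ₂ a) := rfl

variable (K) in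
/-- **The dual action `a ↦ -e'_aᵀ` of `𝔞` on `M'^*`** (A1-95's contragredient morphism `negDualMap` after `ρ'`).
[cite: LooijengaLunts1997, §1 (1.1) p0004 L62–L63 ("taking duals")] -/
def negDualRep (ρ₁ : A →ₗ[K] Module.End K M) : A →ₗ[K] Module.End K (Module.Dual K M) :=
  (negDualMap K M : Module.End K M →ₗ[K] Module.End K (Module.Dual K M)) ∘ₗ ρ₁

/-- `negDualRep ρ' a = -e'_aᵀ`. [cite: LooijengaLunts1997, §1 (1.1) p0004 L62–L63] -/
@[simp] theorem negDualRep_apply (ρ₁ : A →ₗ[K] Module.End K M) (a : A) : negDualRep K ρ₁ a = negDualMap K M (ρ₁ a) :=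
  rfl

/-- `range (negDualRep ρ') = -(range ρ')ᵀ` (the image submodule under `negDualMap`). [cite: LooijengaLunts1997, §1 (1.1) p0004 L62–L63] -/
theorem range_negDualRep (ρ₁ : A →ₗ[K] Module.End K M) :
    LinearMap.range (negDualRep K ρ₁) =
      (LinearMap.range ρ₁).map (negDualMap K M : Module.End K M →ₗ[K] Module.End K (Module.Dual K M)) := by
  rw [negDualRep, LinearMap.range_comp]

end Defs

/-! ### §2 The dictionary `M'^* ⊗ M'' ≅ Hom(M', M'')`: `(-xᵀ) ⊗ 1 + 1 ⊗ y ↦ (φ ↦ y φ - φ x)` -/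

section Dictionary

variable {K : Type*} [Field K] {A : Type*} [AddCommGroup A] [Module K A] {M N : Type*} [AddCommGroup M] [Module K M]
  [FiniteDimensional K M] [AddCommGroup N] [Module K N]

omit [FiniteDimensional K M] in
/-- **Under `ξ ⊗ n ↦ (m ↦ ξ(m) n)` the operator `(-xᵀ) ⊗ 1 + 1 ⊗ y` becomes `φ ↦ y φ - φ x`**:
`dualTensorHom ((-xᵀ ξ) ⊗ n + ξ ⊗ y n) = (m ↦ -ξ(x m) n + ξ(m) y n) = y φ - φ x` for `φ = ξ(·) n`.
[cite: LooijengaLunts1997, §1 (1.1) p0004 L62–L63, L80–L82 ("e_{(a′,a″)}(m′ ⊗ m″) = …")] -/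
theorem dualTensorHom_comp_rTensor_add_lTensor (x : Module.End K M) (y : Module.End K N) :
    dualTensorHom K M N ∘ₗ ((negDualMap K M x).rTensor N + y.lTensor (Module.Dual K M)) =
      homAction K x y ∘ₗ dualTensorHom K M N := by
  refine TensorProduct.ext' fun ξ n ↦ ?_
  refine LinearMap.ext fun m ↦ ?_
  simp only [LinearMap.comp_apply, LinearMap.add_apply, LinearMap.rTensor_tmul, LinearMap.lTensor_tmul, map_add,
    dualTensorHom_apply, negDualMap_apply, LinearMap.neg_apply, LinearMap.dualMap_apply, homAction_apply_apply,
    map_smul, neg_smul]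
  abel

/-- … hence, for Mathlib's isomorphism `Φ = dualTensorHomEquiv : M'^* ⊗ M'' ≃ Hom(M', M'')` (`M'` finite-dimensional):
**`Φ ((-xᵀ) ⊗ 1 + 1 ⊗ y) Φ⁻¹ = homAction x y`.** [cite: LooijengaLunts1997, §1 (1.1) p0004 L62–L63, L80–L82] -/
theorem conj_dualTensorHomEquiv_rTensor_add_lTensor (x : Module.End K M) (y : Module.End K N) :
    (dualTensorHomEquiv K M N).conj ((negDualMap K M x).rTensor N + y.lTensor (Module.Dual K M)) = homAction K x y := by
  have hΦ : ((dualTensorHomEquiv K M N : Module.Dual K M ⊗[K] N ≃ₗ[K] (M →ₗ[K] N)) :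
      Module.Dual K M ⊗[K] N →ₗ[K] (M →ₗ[K] N)) = dualTensorHom K M N :=
    dualTensorHomEquivOfBasis_toLinearMap _
  refine LinearMap.ext fun φ ↦ ?_
  have h1 := LinearMap.congr_fun (dualTensorHom_comp_rTensor_add_lTensor (K := K) x y) ((dualTensorHomEquiv K M N).symm φ)
  rw [LinearMap.comp_apply, LinearMap.comp_apply, ← hΦ, LinearEquiv.coe_coe, LinearEquiv.apply_symm_apply] at h1
  rw [LinearEquiv.conj_apply_apply, h1]

/-- `Φ ∘ (a ↦ (-e'_aᵀ) ⊗ 1 + 1 ⊗ e''_a) ∘ Φ⁻¹ = (a ↦ homAction e'_a e''_a)`: the tensor action of one `𝔞` on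
`M'^* ⊗ M''` (A1-141 `diagTensorRep`) corresponds to `homDiagRep`. [cite: LooijengaLunts1997, §1 (1.1) p0004 L62–L63, L80–L82] -/
theorem conj_dualTensorHomEquiv_comp_diagTensorRep (ρ₁ : A →ₗ[K] Module.End K M) (ρ₂ : A →ₗ[K] Module.End K N) :
    (dualTensorHomEquiv K M N).conj.toLinearMap ∘ₗ diagTensorRep (negDualRep K ρ₁) ρ₂ = homDiagRep K ρ₁ ρ₂ := by
  refine LinearMap.ext fun a ↦ ?_
  rw [LinearMap.comp_apply, diagTensorRep_apply, negDualRep_apply, homDiagRep_apply, LinearEquiv.coe_toLinearMap,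
    conj_dualTensorHomEquiv_rTensor_add_lTensor]

/-- `Φ (range of the tensor action) Φ⁻¹ = range (homDiagRep)`. [cite: LooijengaLunts1997, §1 (1.1) p0004 L62–L63] -/
theorem map_conj_dualTensorHomEquiv_range_diagTensorRep (ρ₁ : A →ₗ[K] Module.End K M) (ρ₂ : A →ₗ[K] Module.End K N) :
    (LinearMap.range (diagTensorRep (negDualRep K ρ₁) ρ₂)).map (dualTensorHomEquiv K M N).conj.toLinearMap =
      LinearMap.range (homDiagRep K ρ₁ ρ₂) := by
  rw [← LinearMap.range_comp]
  exact congrArg LinearMap.range (conj_dualTensorHomEquiv_comp_diagTensorRep ρ₁ ρ₂)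

end Dictionary

/-! ### §3 `Hom(M', M'')` is a Lefschetz `𝔞`-module -/

section Hom

variable {K : Type*} [Field K] [CharZero K] {A : Type*} [AddCommGroup A] [Module K A] {M N : Type*} [AddCommGroup M]
  [Module K M] [FiniteDimensional K M] [AddCommGroup N] [Module K N] [FiniteDimensional K N]
  {h : Module.End K M} {h' : Module.End K N} {ρ₁ : A →ₗ[K] Module.End K M} {ρ₂ : A →ₗ[K] Module.End K N}

/-- The dual `(-𝔞ᵀ, M'^*)` of `(𝔞, M')` in the one-`𝔞` parametrisation (A1-95 `IsLefschetzModule.dual`).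
[cite: LooijengaLunts1997, §1 (1.1) p0004 L62–L63 ("taking duals")] -/
theorem IsLefschetzModule.negDualRep (A₁ : IsLefschetzModule K h (LinearMap.range ρ₁)) :
    IsLefschetzModule K (negDualMap K M h) (LinearMap.range (negDualRep K ρ₁)) := by
  rw [range_negDualRep]
  exact A₁.dual

omit [CharZero K] [FiniteDimensional K M] [FiniteDimensional K N] in
/-- A Lefschetz module is not the zero module. [cite: LooijengaLunts1997, §1 (1.1) p0004 L58–L60] -/
theorem IsLefschetzModule.nontrivial {𝔟 : Submodule K (Module.End K N)} (A₂ : IsLefschetzModule K h' 𝔟) : Nontrivial N := by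
  by_contra hN
  rw [not_nontrivial_iff_subsingleton] at hN
  exact A₂.h_ne_zero (LinearMap.ext fun n ↦ Subsingleton.elim _ _)

/-- **`(𝔞, Hom(M', M''))` IS A LEFSCHETZ MODULE** for the degree operator `h · φ = h'' φ - φ h'` and the action
`e_a · φ = e''_a φ - φ e'_a`, when `(𝔞, M')` and `(𝔞, M'')` are Lefschetz modules ("closed under … tensor products and
taking duals": `Hom(M', M'') ≅ M'^* ⊗ M''` as `𝔞`-modules, transported by A1-142 along `dualTensorHomEquiv`).
[cite: LooijengaLunts1997, §1 (1.1) p0004 L62–L63, (1.3) p0005 L1–L5] -/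
theorem IsLefschetzModule.isLefschetzModule_hom (A₁ : IsLefschetzModule K h (LinearMap.range ρ₁))
    (A₂ : IsLefschetzModule K h' (LinearMap.range ρ₂)) :
    IsLefschetzModule K (homAction K h h') (LinearMap.range (homDiagRep K ρ₁ ρ₂)) := by
  haveI := A₂.nontrivial
  have T := (A₁.negDualRep.isLefschetzModule_diagTensor A₂).conj (dualTensorHomEquiv K M N)
  rwa [map_conj_dualTensorHomEquiv_range_diagTensorRep, conj_dualTensorHomEquiv_rTensor_add_lTensor] at T

/-! ### §4 The invariants of `Hom(M', M'')` are the morphisms of Lefschetz `𝔞`-modules -/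

/-- **MORPHISMS OF LEFSCHETZ `𝔞`-MODULES = `𝔤`-INVARIANTS OF `Hom(M', M'')`**: a linear map `φ : M' → M''` is
invariant under `𝔤(𝔞, Hom(M', M''))` iff `φ h' = h'' φ` (degree `0`) and `φ e'_a = e''_a φ` for all `a` (killed by
`𝔞`) — A1-143's "the invariants are the `𝔞`-invariants of degree `0`" for the Lefschetz module `Hom(M', M'')` of §3;
this is the sense in which "an invariant bilinear form … defines a morphism of Lefschetz modules".
[cite: LooijengaLunts1997, §1 (1.3) p0005 L1–L5, (1.6) proof p0005 L92–L94] -/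
theorem IsLefschetzModule.mem_maxTrivSubmodule_hom_iff (A₁ : IsLefschetzModule K h (LinearMap.range ρ₁))
    (A₂ : IsLefschetzModule K h' (LinearMap.range ρ₂)) {φ : M →ₗ[K] N} :
    φ ∈ maxTrivSubmodule K (lefschetzLieAlgebra K (homAction K h h') (LinearMap.range (homDiagRep K ρ₁ ρ₂))) (M →ₗ[K] N) ↔
      φ ∘ₗ h = h' ∘ₗ φ ∧ ∀ a : A, φ ∘ₗ ρ₁ a = ρ₂ a ∘ₗ φ := by
  rw [(A₁.isLefschetzModule_hom A₂).mem_maxTrivSubmodule_iff, homAction_apply_eq_zero_iff]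
  refine and_congr Iff.rfl ⟨fun H a ↦ ?_, fun H ↦ ?_⟩
  · exact homAction_apply_eq_zero_iff.1 (H _ (LinearMap.mem_range_self _ a))
  · rintro _ ⟨a, rfl⟩
    exact homAction_apply_eq_zero_iff.2 (H a)

/-- … in particular every element of `𝔤(𝔞, Hom(M', M''))` kills the morphisms of Lefschetz `𝔞`-modules (A1-143
`apply_eq_zero_of_mem_lefschetzLieAlgebra`; no Lefschetz hypothesis needed for this direction).
[cite: LooijengaLunts1997, §1 (1.6) proof p0005 L92–L94] -/
theorem apply_eq_zero_of_mem_lefschetzLieAlgebra_hom {φ : M →ₗ[K] N} (hφh : φ ∘ₗ h = h' ∘ₗ φ)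
    (hφ : ∀ a : A, φ ∘ₗ ρ₁ a = ρ₂ a ∘ₗ φ) {z : Module.End K (M →ₗ[K] N)}
    (hz : z ∈ lefschetzLieAlgebra K (homAction K h h') (LinearMap.range (homDiagRep K ρ₁ ρ₂))) : z φ = 0 := by
  refine apply_eq_zero_of_mem_lefschetzLieAlgebra (homAction_apply_eq_zero_iff.2 hφh) ?_ hz
  rintro _ ⟨a, rfl⟩
  exact homAction_apply_eq_zero_iff.2 (hφ a)

end Hom

end Literature.Algebra.Lie
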